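import Literature.Computability.AlgebraicComplexity.GroupTheoreticMatMul
import Mathlib.Data.Finset.Card

/-!
# STPP families: two shared letters force equal indices (the disjointness lemma behind the block order)

Cell `pub-omega`, STPP track (family b′), seat pub-omega-stpp-3. HONEST FRAMING: lottery ticket; floor = certified
bounds/negative ranges. No `ω` content. This file puts into the kernel the elementary lemma on which tonight's engine
repairs and encodings rest (DISAGREE D3 fix `stppsearch5.c` = stpp-2 ENGINE-g4 §U "LEMMA all B-sets (and all C-sets)
of an STPP family are pairwise disjoint (e ∈ every A-set) ⇒ block order = order of min(B)"; ENG2 `stppdfs` symmode 2;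
the SAT lane's block-order clauses, `pub-omega-stpp-2-g4/cnf/README`), for the tree's additive `IsSTPP`
(Cohn–Kleinberg–Szegedy–Umans 2005 Def. 5.1): in the defining implication
`(s' − s) + (t' − t) + (u' − u) = 0 ⇒ i = j = k` (with `s ∈ A k`, `s' ∈ A i`, `t ∈ B i`, `t' ∈ B j`, `u ∈ C j`,
`u' ∈ C k`), choosing two of the three letter pairs EQUAL (a shared element of the two sets involved) and the third pair
equal inside one set makes the left side vanish, so the indices must coincide. Hence two triples that share an
`A`-element have disjoint `B`-sets and disjoint `C`-sets (given a nonempty third set), and under the census normal form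
`0 ∈ Aᵢ` for all `i` the `B`-sets are pairwise disjoint, the `C`-sets are pairwise disjoint, and `Σᵢ |Bᵢ| ≤ |H|`,
`Σᵢ |Cᵢ| ≤ |H|`.

Reference: H. Cohn, R. Kleinberg, B. Szegedy, C. Umans, *Group-theoretic algorithms for matrix multiplication*, FOCS 2005,
arXiv:math/0511460, Def. 5.1.
-/

namespace Summit.MatrixMultiplication.OmegaCensus

open Finset Literature.Computability.AlgebraicComplexity

variable {H : Type*} [AddCommGroup H] {N : ℕ} {A B C : Fin N → Finset H}

/-- **Shared `A`- and `B`-letters force equal indices**: if `A i` and `A j` share an element, `B i` and `B j` share an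
element and `C j` is nonempty, then `i = j` (instantiate CKSU Def. 5.1 at `(i, j, j)` with `s = s'`, `t = t'`, `u = u'`).
[cite: CohnKleinbergSzegedyUmans2005, Def. 5.1] -/
theorem isSTPP_eq_of_shared_A_B (hS : IsSTPP A B C) {i j : Fin N} {a b : H} (haj : a ∈ A j) (hai : a ∈ A i)
    (hbi : b ∈ B i) (hbj : b ∈ B j) (hC : (C j).Nonempty) : i = j := by
  obtain ⟨c, hc⟩ := hC
  exact (hS i j j a haj a hai b hbi b hbj c hc c hc (by simp)).1

/-- **Shared `A`- and `C`-letters force equal indices**: if `A i` and `A k` share an element, `C i` and `C k` share an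
element and `B i` is nonempty, then `i = k` (instantiate at `(i, i, k)`). [cite: CohnKleinbergSzegedyUmans2005, Def. 5.1] -/
theorem isSTPP_eq_of_shared_A_C (hS : IsSTPP A B C) {i k : Fin N} {a c : H} (hak : a ∈ A k) (hai : a ∈ A i)
    (hci : c ∈ C i) (hck : c ∈ C k) (hB : (B i).Nonempty) : i = k := by
  obtain ⟨b, hb⟩ := hB
  have h := hS i i k a hak a hai b hb b hb c hci c hck (by simp)
  exact h.2.1

/-- **Shared `B`- and `C`-letters force equal indices**: if `B i` and `B j` share an element, `C j` and `C i` share an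
element and `A i` is nonempty, then `i = j` (instantiate at `(i, j, i)`). [cite: CohnKleinbergSzegedyUmans2005, Def. 5.1] -/
theorem isSTPP_eq_of_shared_B_C (hS : IsSTPP A B C) {i j : Fin N} {b c : H} (hbi : b ∈ B i) (hbj : b ∈ B j)
    (hcj : c ∈ C j) (hci : c ∈ C i) (hA : (A i).Nonempty) : i = j := by
  obtain ⟨a, ha⟩ := hA
  exact (hS i j i a ha a ha b hbi b hbj c hcj c hci (by simp)).1

/-- **`B`-sets of triples sharing an `A`-element are disjoint** (for `i ≠ j`, a common element
`a ∈ A i ∩ A j`, and `C j` nonempty). [cite: CohnKleinbergSzegedyUmans2005, Def. 5.1] -/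
theorem isSTPP_disjoint_B (hS : IsSTPP A B C) {i j : Fin N} (hij : i ≠ j) {a : H} (hai : a ∈ A i)
    (haj : a ∈ A j) (hC : (C j).Nonempty) : Disjoint (B i) (B j) :=
  Finset.disjoint_left.2 fun _ hbi hbj => hij (isSTPP_eq_of_shared_A_B hS haj hai hbi hbj hC)

/-- **`C`-sets of triples sharing an `A`-element are disjoint** (for `i ≠ k` with `B i` nonempty).
[cite: CohnKleinbergSzegedyUmans2005, Def. 5.1] -/
theorem isSTPP_disjoint_C (hS : IsSTPP A B C) {i k : Fin N} (hik : i ≠ k) {a : H} (hai : a ∈ A i)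
    (hak : a ∈ A k) (hB : (B i).Nonempty) : Disjoint (C i) (C k) :=
  Finset.disjoint_left.2 fun _ hci hck => hik (isSTPP_eq_of_shared_A_C hS hak hai hci hck hB)

/-- **`A`-sets of triples sharing a `C`-element are disjoint** (for `i ≠ k` with `B i` nonempty).
[cite: CohnKleinbergSzegedyUmans2005, Def. 5.1] -/
theorem isSTPP_disjoint_A (hS : IsSTPP A B C) {i k : Fin N} (hik : i ≠ k) {c : H} (hci : c ∈ C i)
    (hck : c ∈ C k) (hB : (B i).Nonempty) : Disjoint (A i) (A k) :=
  Finset.disjoint_left.2 fun _ hai hak => hik (isSTPP_eq_of_shared_A_C hS hak hai hci hck hB)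

/-- **Normal form ⇒ the `B`-sets are pairwise disjoint**: if every `Aᵢ` contains `0` (the census normal form: one
translation per triple) and every `Cᵢ` is nonempty, the `B`-sets of an STPP family are pairwise disjoint — the lemma
behind the 'block order by `min Bᵢ`' symmetry reduction. [cite: CohnKleinbergSzegedyUmans2005, Def. 5.1] -/
theorem isSTPP_pairwiseDisjoint_B (hS : IsSTPP A B C) (h0 : ∀ i, (0 : H) ∈ A i) (hC : ∀ i, (C i).Nonempty) :
    Pairwise fun i j => Disjoint (B i) (B j) := by
  intro i j hij
  exact isSTPP_disjoint_B hS hij (h0 i) (h0 j) (hC j)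

/-- **Normal form ⇒ the `C`-sets are pairwise disjoint** (every `Aᵢ ∋ 0`, every `Bᵢ` nonempty).
[cite: CohnKleinbergSzegedyUmans2005, Def. 5.1] -/
theorem isSTPP_pairwiseDisjoint_C (hS : IsSTPP A B C) (h0 : ∀ i, (0 : H) ∈ A i) (hB : ∀ i, (B i).Nonempty) :
    Pairwise fun i k => Disjoint (C i) (C k) := by
  intro i k hik
  exact isSTPP_disjoint_C hS hik (h0 i) (h0 k) (hB i)

/-- **Packing consequence of the normal form**: with `0 ∈ Aᵢ` for all `i` and all `Cᵢ` nonempty, the `B`-sets of an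
STPP family in a finite abelian group are pairwise disjoint, so `Σᵢ |Bᵢ| ≤ |H|`. [cite: CohnKleinbergSzegedyUmans2005, Def. 5.1] -/
theorem isSTPP_sum_card_B_le [Fintype H] (hS : IsSTPP A B C) (h0 : ∀ i, (0 : H) ∈ A i)
    (hC : ∀ i, (C i).Nonempty) : ∑ i, (B i).card ≤ Fintype.card H := by
  classical
  have hdisj : Set.PairwiseDisjoint (↑(Finset.univ : Finset (Fin N))) B := by
    intro i _ j _ hij
    exact isSTPP_pairwiseDisjoint_B hS h0 hC hij
  calc ∑ i, (B i).card = (Finset.univ.biUnion B).card := (Finset.card_biUnion hdisj).symm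
    _ ≤ Fintype.card H := Finset.card_le_univ _

/-- **Packing consequence of the normal form for the `C`-sets**: `Σᵢ |Cᵢ| ≤ |H|` when `0 ∈ Aᵢ` for all `i` and all
`Bᵢ` are nonempty. [cite: CohnKleinbergSzegedyUmans2005, Def. 5.1] -/
theorem isSTPP_sum_card_C_le [Fintype H] (hS : IsSTPP A B C) (h0 : ∀ i, (0 : H) ∈ A i)
    (hB : ∀ i, (B i).Nonempty) : ∑ i, (C i).card ≤ Fintype.card H := by
  classical
  have hdisj : Set.PairwiseDisjoint (↑(Finset.univ : Finset (Fin N))) C := by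
    intro i _ k _ hik
    exact isSTPP_pairwiseDisjoint_C hS h0 hB hik
  calc ∑ i, (C i).card = (Finset.univ.biUnion C).card := (Finset.card_biUnion hdisj).symm
    _ ≤ Fintype.card H := Finset.card_le_univ _

end Summit.MatrixMultiplication.OmegaCensus
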